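import Summits.QuantumFields.BalabanUV.Beta.GAN24.Push4
import Summits.QuantumFields.BalabanUV.Beta.GAN24.CombesThomas
import Literature.MathematicalPhysics.QuantumFieldTheory.Balaban1983to89.Beta.BalabanCompositeJets

/-!
# `BalabanUV.Beta.GAN24.RespStepSemigroup` — binder row G-an2-4 / (CONV-C), W-slot road «W3» (gan24-p1-g5 `SKELETON-W3.md` v0.2 §2 W3-L1 ∕ §7.3;
# RULINGS-13 (R13-2) invitation «W3-LEGS*», journal INTENT l.7566 ∕ PART 2 l.7804): THE SEMIGROUP LAW OF THE (K1b′) RESPONSE FAMILIES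
# `respStep M N′` AND THE LEG DICTIONARY OF THE NORMALISED STEP RESOLVENT `K̃_j = KStepUnit Lc j` (`colH K̃_j Lc = respStep (Lc^j) (Lc^(j+1))`,
# `rowM K̃_j Lc = −respStep (Lc^j) (Lc^(j+1))`) — so that the ITERATED leg families of the composite four-leg push ARE `±respStep (Lc^m) (Lc^n)`

NOT IN PRINT; OUR PROOF ATTEMPT (of the road; THIS file is [folklore] bookkeeping: exact identities over the tree's definitions BY NAME — an5∕an2's
`ResolventComposition.wH_reproduction` (the minimiser-column reproduction `ℋ_{N″} = Σ (𝒬_{N′}ℋ_{N″})·ℋ_{N′}`), `contourSum_Hcol`, `KInvStep_inr_inl`,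
an2's `BalabanCompositeJets.respStep` ∕ `respStep_eq` ∕ `summable_respStep`, leaf-17's `Push4.legComp` ∕ `rowM` ∕ `colH_apply'`, gan24-p1's
`CombesThomas.KStepUnit`; NO estimate, NO constant, NO rate, NO `def`, NO `def … : Prop`, NO cited fact, NO wall binder).  Credit: the «semigroup in
units» is item (L-W-3) of leaf-16-g11's design note `W-SLOT-CHARGE.md` §4 (journal l.7482), confirmed there in float64 (kit j090373) — typed here.
HONEST FRAMING (cell contract, verbatim): «discharging `BetaPertH` makes Bałaban's UV stability UNCONDITIONAL — a real constructive-QFT result; it is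
NOT the continuum limit and NOT the Clay problem.»  HONEST DEPENDENCY (verbatim): «continuum YM on T⁴ ⇐ BetaPertH ∧ nine spine estimates (0/9 proved);
BetaPertH ⇐ (D1) ∧ (D4) ∧ CAP+tail; G-an2-4 gates asym, D1 and NE2/3/4.»  Discharges NOTHING of «T2Shape» ∕ «T2SupRate» ∕ (hW₂, hW₂all); NOT a LEAVES
row; 0∕2 wall binders instantiated; NOT `BetaPertH`, NOT continuum, NOT Clay.

## Why (SKELETON-W3 §2 W3-L1, §7.3)
The linear part `𝒜_j` of the normalised `T₂`-recursion is a four-leg push `push₄ (rowM K̃_j Lc) (colH K̃_j Lc)` (leaf-17's `Push4.mmRead_sandwich_vertex2OfK_eq_push₄`);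
nesting pushes composes the leg families by `Push4.legComp` (`comp_Lk_Lk`, `comp_Rk_Rk`).  This module identifies those composites: BOTH one-step leg families
of `K̃_j` are `±` an2's response family `respStep (Lc^j) (Lc^(j+1))` (§2), and response families compose as a SEMIGROUP along `M ∣ N′ ∣ N″` (§1), so every
iterated leg from level `Lc^m` to level `Lc^n` is `±respStep (Lc^m) (Lc^n)` (§3) — the object whose (N1)∕(N1′)-type sup and unit-gradient bounds, uniform
in the pair of levels, are `RespStepDecay.exists_respStep_decay_and_grad` (p211190).

## What is proved (generic `d`)
* §1 **`respStep_semigroup`** (`N′ = M·L`, `N″ = N′·L′`): `∑'_v ∑_λ respStep N′ N″ μ y λ v · respStep M N′ λ v κ u = respStep M N″ μ y κ u`;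
  **`legComp_respStep`**: the same as `legComp (respStep M N′) (respStep N′ N″) = respStep M N″` (leaf-17's convention: coarse ← middle ← fine);
  `respStep_self` (the identity leg `respStep M M μ z l″ w′ = [w′ = z ∧ l″ = μ]`); `summable_respStep_mul_bdd` (the summability behind the interchange).
* §2 **`colH_KStepUnit`**: `colH (KStepUnit Lc j) Lc = respStep (Lc^j) (Lc^(j+1))` (`s_f·s_m = (Lc^j)^{d+2}` cancels `respStep_eq`'s normalisation exactly;
  the entry form is the D1-road's `FP/StationarityJConvC.respStep_eq_KStepUnit`, not imported); **`rowM_KStepUnit`**: `rowM (KStepUnit Lc j) Lc α x′ κ x =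
  −respStep (Lc^j) (Lc^(j+1)) α x′ κ x` (`ℋ♭ = −ℋᵀ`, `KInvStep_inr_inl`).
* §3 `legComp_neg_left` ∕ `legComp_neg_right` ∕ `legComp_neg_neg` (signs ride through the composition); **`legComp_respStep_pow`**:
  `legComp (respStep (Lc^m) (Lc^(m+k))) (respStep (Lc^(m+k)) (Lc^(m+k+1))) = respStep (Lc^m) (Lc^(m+k+1))` — the induction step of the k-fold composite
  from level `m`; **`legComp_respStep_colH`** ∕ **`legComp_respStep_rowM`**: the same with the last factor written as the one-step leg `colH K̃_{m+k} Lc` ∕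
  `rowM K̃_{m+k} Lc` (sign `−` for the row leg).
Unit `b2b-balaban-gan24-formalise-leaf-12` (G-an2-4 formalisation swarm, leaf prover 12, gen 20; idle-seat one-shot piece «W3-LEGS*» PART 2), 2026-08-20.
-/

noncomputable section

open Finset
open scoped BigOperators
open Literature.MathematicalPhysics.QuantumFieldTheory.Balaban1983to89
open Literature.MathematicalPhysics.QuantumFieldTheory.Balaban1983to89.Beta
open KernelSpecInstance (wH)
open AffineAveraging (contourSum box toSite unitVec)
open ResolventComposition (Hcol Hcol_apply Hcol_bdd_summable wH_reproduction contourSum_Hcol KInvStep_inr_inl)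
open BalabanCompositeJets (respStep respStep_eq summable_respStep)
open KKTFluctuationEnergy (summable_mul_of_bdd')
open OneStepKernelFamily (colH KInvStep)
open Summit.QuantumFields.BalabanUV.Beta.HessKerDressedUnits (unitK unitK_apply legScale_inl legScale_inr)
open Summit.QuantumFields.BalabanUV.Beta.GAN24.CombesThomas (KStepUnit sfStep smStep)
open Summit.QuantumFields.BalabanUV.Beta.GAN24.Push4 (legComp legComp_apply rowM rowM_apply colH_apply')

namespace Summit.QuantumFields.BalabanUV.Beta.GAN24.RespStepSemigroup

variable {d : ℕ}

/-! ## §1 The semigroup law of the response families -/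

section Semigroup

variable {M N' L' N'' : ℕ} [NeZero M] [NeZero N'] [NeZero L'] [NeZero N'']

omit [NeZero L'] [NeZero N''] in
/-- [folklore] The summability behind every interchange: `v ↦ respStep M N′ μ y λ v · (bounded)` is summable (`summable_respStep` × bounded). -/
theorem summable_respStep_mul_bdd (μ : Fin (d + 1)) (y : Fin (d + 1) → ℤ) (lam : Fin (d + 1)) {g : (Fin (d + 1) → ℤ) → ℝ} {C : ℝ}
    (hg : ∀ v, |g v| ≤ C) : Summable fun v => respStep (d := d) M N' μ y lam v * g v :=
  summable_mul_of_bdd' (summable_respStep M N' μ y lam) hg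

omit [NeZero M] [NeZero N'] [NeZero L'] [NeZero N''] in
/-- [folklore] **THE IDENTITY LEG**: `respStep M M μ z l″ w′ = [w′ = z ∧ l″ = μ]` (the (Q) normalisation `contourSum_Hcol` of the minimiser columns). -/
theorem respStep_self (M : ℕ) [NeZero M] (μ : Fin (d + 1)) (z : Fin (d + 1) → ℤ) (l'' : Fin (d + 1)) (w' : Fin (d + 1) → ℤ) :
    respStep (d := d) M M μ z l'' w' = if w' = z ∧ l'' = μ then 1 else 0 :=
  contourSum_Hcol (N := M) μ z l'' w'

omit [NeZero M] in
/-- [folklore] **THE SEMIGROUP LAW OF THE (K1b′) RESPONSE FAMILIES** along `N′ ∣ N″` (`N″ = N′·L′`; the read-out blocking `M` is ARBITRARY —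
the `M`-contour sum is a finite linear read-out): `∑'_v ∑_λ respStep N′ N″ μ y λ v · respStep M N′ λ v κ u = respStep M N″ μ y κ u` — the `M`-block-contour
sum of the level-`N″` minimiser column is the superposition of the `M`-block-contour sums of the level-`N′` columns weighted by the `N′`-block-contour sums
of the level-`N″` column.  PROOF: an5∕an2's reproduction `wH_reproduction` (`ℋ_{N″}(x₀) = Σ_{(λ,v)} (𝒬_{N′}ℋ_{N″})(λ,v)·ℋ_{N′}(x₀; λ, v)`) at each of the
`M^{d+1}·M` contour points, one interchange of the finite contour sum with the `v`-series (`summable_respStep` × `Hcol_bdd_summable`). -/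
theorem respStep_semigroup (hN'' : N'' = N' * L') (μ : Fin (d + 1)) (y : Fin (d + 1) → ℤ) (κ : Fin (d + 1))
    (u : Fin (d + 1) → ℤ) :
    ∑' v : Fin (d + 1) → ℤ, ∑ lam : Fin (d + 1), respStep (d := d) N' N'' μ y lam v * respStep (d := d) M N' lam v κ u
      = respStep (d := d) M N'' μ y κ u := by
  obtain ⟨C, _, hCb, _⟩ := Hcol_bdd_summable (N := N') (d := d)
  -- the bounded weights `W b s λ v := wH_{N′} κ λ (x₀(b,s) − N′•v)` and the summable responses `R λ v := respStep N′ N″ μ y λ v`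
  set x₀ : (Fin (d + 1) → ℕ) → ℕ → (Fin (d + 1) → ℤ) := fun b s => (M : ℤ) • u + toSite b + (s : ℤ) • unitVec κ with hx₀
  have hWb : ∀ b s lam v, |wH (N := N') κ lam (x₀ b s - (N' : ℤ) • v)| ≤ C := fun b s lam v => by
    have h := hCb lam v κ (x₀ b s); rwa [Hcol_apply] at h
  have hsum : ∀ b s, Summable fun v : Fin (d + 1) → ℤ =>
      ∑ lam : Fin (d + 1), respStep (d := d) N' N'' μ y lam v * wH (N := N') κ lam (x₀ b s - (N' : ℤ) • v) :=
    fun b s => summable_sum fun lam _ => summable_respStep_mul_bdd μ y lam (hWb b s lam)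
  -- RIGHT side: unfold the `M`-contour sum of `ℋ_{N″}` and reproduce every column value at level `N′`
  have rhs : respStep (d := d) M N'' μ y κ u = ∑ b ∈ box (d + 1) M, ∑ s ∈ Finset.range M,
      ∑' v : Fin (d + 1) → ℤ, ∑ lam : Fin (d + 1), respStep (d := d) N' N'' μ y lam v * wH (N := N') κ lam (x₀ b s - (N' : ℤ) • v) := by
    unfold respStep contourSum
    refine Finset.sum_congr rfl fun b _ => Finset.sum_congr rfl fun s _ => ?_
    rw [Hcol_apply]
    exact wH_reproduction hN'' μ y κ (x₀ b s)
  -- LEFT side: the inner `respStep M N′ λ v κ u` is the same finite contour sum of `ℋ_{N′}(·; λ, v)`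
  have lhs : ∀ v lam, respStep (d := d) M N' lam v κ u = ∑ b ∈ box (d + 1) M, ∑ s ∈ Finset.range M,
      wH (N := N') κ lam (x₀ b s - (N' : ℤ) • v) := by
    intro v lam
    unfold respStep contourSum
    refine Finset.sum_congr rfl fun b _ => Finset.sum_congr rfl fun s _ => ?_
    rw [Hcol_apply]
  rw [rhs]
  -- interchange the finite `(b, s)` sums with the `v`-series
  have swap_s : ∀ b ∈ box (d + 1) M, (∑ s ∈ Finset.range M, ∑' v : Fin (d + 1) → ℤ,
      ∑ lam : Fin (d + 1), respStep (d := d) N' N'' μ y lam v * wH (N := N') κ lam (x₀ b s - (N' : ℤ) • v))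
      = ∑' v : Fin (d + 1) → ℤ, ∑ s ∈ Finset.range M,
          ∑ lam : Fin (d + 1), respStep (d := d) N' N'' μ y lam v * wH (N := N') κ lam (x₀ b s - (N' : ℤ) • v) :=
    fun b _ => (Summable.tsum_finsetSum fun s _ => hsum b s).symm
  rw [Finset.sum_congr rfl swap_s]
  rw [← Summable.tsum_finsetSum fun b _ => summable_sum fun s _ => hsum b s]
  refine tsum_congr fun v => ?_
  -- per `v`: pull the responses out of the finite contour sums
  symm
  calc ∑ b ∈ box (d + 1) M, ∑ s ∈ Finset.range M, ∑ lam : Fin (d + 1),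
          respStep (d := d) N' N'' μ y lam v * wH (N := N') κ lam (x₀ b s - (N' : ℤ) • v)
      = ∑ b ∈ box (d + 1) M, ∑ lam : Fin (d + 1), ∑ s ∈ Finset.range M,
          respStep (d := d) N' N'' μ y lam v * wH (N := N') κ lam (x₀ b s - (N' : ℤ) • v) :=
        Finset.sum_congr rfl fun b _ => Finset.sum_comm
    _ = ∑ lam : Fin (d + 1), ∑ b ∈ box (d + 1) M, ∑ s ∈ Finset.range M,
          respStep (d := d) N' N'' μ y lam v * wH (N := N') κ lam (x₀ b s - (N' : ℤ) • v) := Finset.sum_comm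
    _ = ∑ lam : Fin (d + 1), respStep (d := d) N' N'' μ y lam v * respStep (d := d) M N' lam v κ u := by
        refine Finset.sum_congr rfl fun lam _ => ?_
        rw [lhs v lam, Finset.mul_sum]
        exact Finset.sum_congr rfl fun b _ => by rw [Finset.mul_sum]

omit [NeZero M] in
/-- [folklore] **THE SEMIGROUP LAW IN leaf-17's `legComp` CONVENTION** (coarse ← middle ← fine): `legComp (respStep M N′) (respStep N′ N″) = respStep M N″`. -/
theorem legComp_respStep (hN'' : N'' = N' * L') :
    legComp (respStep (d := d) M N') (respStep (d := d) N' N'') = respStep (d := d) M N'' := by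
  funext μ y κ u
  rw [legComp_apply]
  exact respStep_semigroup hN'' μ y κ u

end Semigroup

/-! ## §2 The leg dictionary of the normalised step resolvent -/

section Dictionary

variable {Lc : ℕ} [NeZero Lc]

/-- [folklore] **THE COLUMN LEG OF `K̃_j` IS THE ONE-STEP RESPONSE FAMILY**: `colH (KStepUnit Lc j) Lc = respStep (Lc^j) (Lc^(j+1))` — the leg units
`s_f(j)·s_m(j) = Lc^j·Lc^{j(d+1)} = (Lc^j)^{d+2}` cancel the normalisation of an2's `respStep_eq` exactly (no residual power of `Lc^j`). -/
theorem colH_KStepUnit (j : ℕ) :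
    colH (KStepUnit (d := d) Lc j) Lc = respStep (d := d) (Lc ^ j) (Lc ^ (j + 1)) := by
  funext μ z κ u
  rw [colH_apply', KStepUnit, unitK_apply, legScale_inl, legScale_inr, sfStep, smStep, respStep_eq]
  push_cast
  ring

/-- [folklore] **THE ROW LEG OF `K̃_j` IS MINUS THE ONE-STEP RESPONSE FAMILY**: `rowM (KStepUnit Lc j) Lc α x′ κ x = −respStep (Lc^j) (Lc^(j+1)) α x′ κ x`
(an5's antisymmetry `ℋ♭ = −ℋᵀ` in the form `KInvStep_inr_inl`). -/
theorem rowM_KStepUnit (j : ℕ) (α : Fin (d + 1)) (x' : Fin (d + 1) → ℤ) (κ : Fin (d + 1)) (x : Fin (d + 1) → ℤ) :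
    rowM (KStepUnit (d := d) Lc j) Lc α x' κ x = -respStep (d := d) (Lc ^ j) (Lc ^ (j + 1)) α x' κ x := by
  rw [rowM_apply, KStepUnit, unitK_apply, legScale_inl, legScale_inr, sfStep, smStep, KInvStep_inr_inl]
  unfold respStep
  have hc : (((Lc ^ j : ℕ) : ℝ)) ^ (d + 2) ≠ 0 := pow_ne_zero _ (by exact_mod_cast pow_ne_zero j (NeZero.ne Lc))
  have e : (Lc : ℝ) ^ (j * (d + 1)) * (Lc : ℝ) ^ j = (((Lc ^ j : ℕ) : ℝ)) ^ (d + 2) := by push_cast; ring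
  calc (Lc : ℝ) ^ (j * (d + 1)) * -(((((Lc ^ j : ℕ) : ℝ)) ^ (d + 2))⁻¹ *
          contourSum (Lc ^ j) (Hcol (N := Lc ^ (j + 1)) α x') κ x) * (Lc : ℝ) ^ j
      = -(((Lc : ℝ) ^ (j * (d + 1)) * (Lc : ℝ) ^ j) * ((((Lc ^ j : ℕ) : ℝ)) ^ (d + 2))⁻¹ *
          contourSum (Lc ^ j) (Hcol (N := Lc ^ (j + 1)) α x') κ x) := by ring
    _ = -contourSum (Lc ^ j) (Hcol (N := Lc ^ (j + 1)) α x') κ x := by rw [e, mul_inv_cancel₀ hc, one_mul]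

/-- [folklore] The row leg as a family: `rowM (KStepUnit Lc j) Lc = −respStep (Lc^j) (Lc^(j+1))`. -/
theorem rowM_KStepUnit_eq (j : ℕ) :
    rowM (KStepUnit (d := d) Lc j) Lc = -respStep (d := d) (Lc ^ j) (Lc ^ (j + 1)) := by
  funext α x' κ x
  rw [rowM_KStepUnit]
  rfl

end Dictionary

/-! ## §3 Signs ride through the composition; the induction step of the k-fold composite legs -/

section Iterate

/-- [folklore] A sign on the outer leg comes out of the composition. -/
theorem legComp_neg_left (r₂ r₁ : Fin (d + 1) → (Fin (d + 1) → ℤ) → Fin (d + 1) → (Fin (d + 1) → ℤ) → ℝ) :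
    legComp (-r₂) r₁ = -legComp r₂ r₁ := by
  funext μ y κ u
  simp only [legComp_apply, Pi.neg_apply, mul_neg, Finset.sum_neg_distrib, tsum_neg]

/-- [folklore] A sign on the inner leg comes out of the composition. -/
theorem legComp_neg_right (r₂ r₁ : Fin (d + 1) → (Fin (d + 1) → ℤ) → Fin (d + 1) → (Fin (d + 1) → ℤ) → ℝ) :
    legComp r₂ (-r₁) = -legComp r₂ r₁ := by
  funext μ y κ u
  simp only [legComp_apply, Pi.neg_apply, neg_mul, Finset.sum_neg_distrib, tsum_neg]

/-- [folklore] Two signs cancel: `legComp (−r₂) (−r₁) = legComp r₂ r₁`. -/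
theorem legComp_neg_neg (r₂ r₁ : Fin (d + 1) → (Fin (d + 1) → ℤ) → Fin (d + 1) → (Fin (d + 1) → ℤ) → ℝ) :
    legComp (-r₂) (-r₁) = legComp r₂ r₁ := by
  rw [legComp_neg_left, legComp_neg_right, neg_neg]

variable {Lc : ℕ} [NeZero Lc]

/-- [folklore] **THE INDUCTION STEP OF THE k-FOLD COMPOSITE FROM LEVEL `m`**: composing the response family `Lc^m ← Lc^(m+k)` with the one-step
family `Lc^(m+k) ← Lc^(m+k+1)` gives `Lc^m ← Lc^(m+k+1)`. -/
theorem legComp_respStep_pow (m k : ℕ) :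
    legComp (respStep (d := d) (Lc ^ m) (Lc ^ (m + k))) (respStep (d := d) (Lc ^ (m + k)) (Lc ^ (m + k + 1)))
      = respStep (d := d) (Lc ^ m) (Lc ^ (m + k + 1)) :=
  legComp_respStep (L' := Lc) (pow_succ Lc (m + k))

/-- [folklore] The same with the last factor written as the COLUMN leg of the normalised step resolvent `K̃_{m+k}`. -/
theorem legComp_respStep_colH (m k : ℕ) :
    legComp (respStep (d := d) (Lc ^ m) (Lc ^ (m + k))) (colH (KStepUnit (d := d) Lc (m + k)) Lc)
      = respStep (d := d) (Lc ^ m) (Lc ^ (m + k + 1)) := by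
  rw [colH_KStepUnit]
  exact legComp_respStep_pow m k

/-- [folklore] The same with the last factor written as the ROW leg of `K̃_{m+k}` (one sign): for the row legs the k-fold composite from level `m`
is `(−1)^k • respStep (Lc^m) (Lc^(m+k))`, and this is its induction step. -/
theorem legComp_respStep_rowM (m k : ℕ) :
    legComp (respStep (d := d) (Lc ^ m) (Lc ^ (m + k))) (rowM (KStepUnit (d := d) Lc (m + k)) Lc)
      = -respStep (d := d) (Lc ^ m) (Lc ^ (m + k + 1)) := by
  rw [rowM_KStepUnit_eq, legComp_neg_right, legComp_respStep_pow]

/-- [folklore] The first step from level `m` (`k = 0`): the identity leg composed with the one-step column leg is the one-step response family itself,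
`legComp (respStep (Lc^m) (Lc^m)) (colH K̃_m Lc) = respStep (Lc^m) (Lc^(m+1))`. -/
theorem legComp_respStep_colH_zero (m : ℕ) :
    legComp (respStep (d := d) (Lc ^ m) (Lc ^ m)) (colH (KStepUnit (d := d) Lc m) Lc)
      = respStep (d := d) (Lc ^ m) (Lc ^ (m + 1)) := by
  rw [colH_KStepUnit]
  exact legComp_respStep (L' := Lc) (pow_succ Lc m)

end Iterate

end Summit.QuantumFields.BalabanUV.Beta.GAN24.RespStepSemigroup

end
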